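import Literature.NumberTheory.EllipticCurves.QuadraticTwistKroneckerEvenLFunctionProofs
import Literature.NumberTheory.EllipticCurves.ArtinFormalismSemistableLocalProofs
import Literature.NumberTheory.EllipticCurves.ModularityVersionApProofs
import Literature.NumberTheory.EllipticCurves.AnalyticRankLSeriesSummableProofs
import Literature.NumberTheory.QuadraticFields.FundamentalDiscriminant
import Literature.NumberTheory.Automorphic.LanglandsTunnellLSeriesProofs
import HarnessLib

/-!
# The Euler product of a quadratic twist by a fundamental discriminant:
# `a_{p^k}(E^{(d)}) = χ_d(p)^k a_{p^k}(E)` at every prime and `L(E^{(d)}, s) = ∏_p (1 − χ_d(p) a_p p⁻ˢ + 𝟙_N(p) p χ_d(p)² p⁻²ˢ)⁻¹`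

Topic `NumberTheory/EllipticCurves` (theorems only; no definition, no named fact; dot-notation
extensions of Mathlib's `WeierstrassCurve` namespace as in the tree's `QuadraticTwist*Proofs`
files). Let `E / ℚ` be an elliptic curve (any model `W`), `d` a FUNDAMENTAL DISCRIMINANT (tree
spelling `(d % 4 = 1 ∧ Squarefree d ∧ d ≠ 1) ∨ (4 ∣ d ∧ (d/4 % 4 = 2 ∨ d/4 % 4 = 3) ∧ Squarefree (d/4))`),
and write `χ_d(p) ∈ {0, ±1}` for the value at the prime `p` of the Kronecker character of `ℚ(√d)`:
`(d / p)` (`J(d | p)`) for odd `p`; for `p = 2`: `0`, `+1`, `−1` as `d` is even, `≡ 1`, `≡ 5 (mod 8)`.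

* §1 `localPolynomialAt_quadraticTwist_discr_eq_one_of_dvd_of_isSemistableAt` — **the twist
  `E^{(d_K)}` has trivial local polynomial at a ramified prime `p ∣ d_K` of SEMISTABLE reduction**
  (good OR multiplicative; any `p`, `K` quadratic): from the ramified case of Artin formalism
  `L_w(E_K) = L_v(E) · L_v(E^{(d_K)})` (tree `localPolynomialAt_baseChange_quadratic`) and the
  semistable base change `L_w(E_K, T) = L_v(E, T)` at a place with `f(w|v) = 1` (tree
  `localPolynomialAt_baseChange_of_isSemistableAt`, Silverman *AEC* VII.5.4), cancelling `L_v(E) ≠ 0`.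
  This extends the tree's good-reduction lemma `localPolynomialAt_quadraticTwist_discr_eq_one_of_dvd`
  (`QuadraticTwistRamifiedLocalPolynomialProofs`) to multiplicative primes — the case "`p` divides
  both `d_K` and `N`, `ord_p(N) = 1`" of Gross 2004 §1 / Cai–Shu–Tian's Heegner condition (1).
* §2 `LFunction_quadraticTwist_prime_pow_of_fundamental` — **`a_{p^k}(E^{(d)}) = χ_d(p)^k a_{p^k}(E)`**
  for every prime `p` and `k ≥ 0`, provided `E` is semistable at the primes dividing `d` (the
  coefficients of Mathlib's `WeierstrassCurve.LFunction`; at `p ∤ d` the local factor of the twist is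
  the rescaling by `χ_d(p)` of that of `E` — tree `localEulerFactor_quadraticTwist_of_odd_of_not_dvd`,
  `…_two_of_emod_four_eq_one`, `…_four_mul_of_not_dvd` — and at `p ∣ d` it is `1` by §1).
* §3 `hasProd_LSeries_quadraticTwist_of_fundamental` — **`L(E^{(d)}, s) = ∏_p (1 − χ_d(p) a_p(E) p⁻ˢ + e_p χ_d(p)² p⁻²ˢ)⁻¹`**
  (`HasProd` over `Nat.Primes`, `re s > 3/2`, `e_p = p 𝟙_{p ∤ N_E}`): the Euler product of the
  multiplicative coefficients `aₙ(E^{(d)})` (Hasse bound, tree `LSeriesSummable_of_lt_re_holds`;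
  recursion `a_{p^{k+2}} = a_p a_{p^{k+1}} − e_p a_{p^k}`, tree `LFunction_apply_prime_pow_add_two_of_prime`;
  tree `Automorphic.LSeries_hasProd_of_recurrence`) with `a_p(E^{(d)}) = χ_d(p) a_p` and
  `e_p(E^{(d)}) = χ_d(p)² e_p` read off §2 at `k = 1, 2`.

These are the `p`-Euler factors `L(A_i, s)` in Gross's factorisation `L(f, χ, s) = L(A₁, s) L(A₂, s)`
(MSRI Publ. 49 §2 p. 40; `Aᵢ = E^{(dᵢ)}`), consumed by `Gross2004/RationalCharacterLSeriesHolds.lean`.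

## References

* [SilvermanAEC2009] J. H. Silverman, *The Arithmetic of Elliptic Curves*, 2nd ed., VII.5.4, X.2,
  §C.16.
* [IrelandRosen1990] K. Ireland, M. Rosen, *A Classical Introduction to Modern Number Theory*,
  2nd ed., Prop. 20.5.4(b).
* [Gross2004] B. H. Gross, *Heegner points and representation theory*, MSRI Publ. 49 (2004), §2.
* [DiamondShurman2005] F. Diamond, J. Shurman, *A First Course in Modular Forms*, Thm. 5.9.2,
  (8.44).
-/

noncomputable section

open scoped Classical NumberTheorySymbols

namespace WeierstrassCurve

open IsDedekindDomain IsDedekindDomain.HeightOneSpectrum NumberField Rat.HeightOneSpectrum IsLocalRing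
  Polynomial

/-! ## §1 `L_v(E^{(d_K)}, T) = 1` at a ramified prime of semistable reduction -/

section Semistable

variable (W : WeierstrassCurve ℚ) [W.IsElliptic] (K : Type) [Field K] [NumberField K]

/-- **`L_v(E^{(d_K)}, T) = 1` at a ramified prime of semistable reduction** (any `p`, including
`2`): for a quadratic field `K`, a prime `p ∣ d_K` (place `v`) at which `E` is semistable (good or
multiplicative reduction), Mathlib's local polynomial of the twist `E^{(d_K)}` at `v` is `1`. From
the ramified case of Artin formalism `L_w(E_K) = L_v(E) · L_v(E^{(d_K)})`
(`localPolynomialAt_baseChange_quadratic`; Ireland–Rosen Prop. 20.5.4(b)) and the semistable base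
change `L_w(E_K) = L_v(E)` at the place `w` with `f(w|v) = 1`
(`localPolynomialAt_baseChange_of_isSemistableAt`; Silverman *AEC* VII.5.4(b)), by cancelling
`L_v(E) ≠ 0` in `ℤ[T]`. [cite: SilvermanAEC2009, VII.5.4 and §C.16]
[cite: IrelandRosen1990, Ch. 20 §5, Prop. 20.5.4(b)] -/
theorem localPolynomialAt_quadraticTwist_discr_eq_one_of_dvd_of_isSemistableAt
    (h2 : Module.finrank ℚ K = 2) (v : HeightOneSpectrum (𝓞 ℚ))
    (hv : ((primesEquiv v : ℕ) : ℤ) ∣ NumberField.discr K) (hss : W.IsSemistableAt v) :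
    (W.quadraticTwist (NumberField.discr K : ℚ)).localPolynomialAt v = 1 := by
  haveI : FiniteDimensional ℚ K := Module.finite_of_finrank_pos (by rw [h2]; exact two_pos)
  obtain ⟨w, hw, huniq, hf1⟩ := exists_unique_place_of_dvd_discr K h2 v hv
  have hmul := (W.localPolynomialAt_baseChange_quadratic K h2 (v := v) (w := w) hw).2.2 huniq hf1
  obtain ⟨t, δ, hvL, -⟩ := (W.baseChange (v.adicCompletion ℚ)).exists_localPolynomial_eq
    (v.adicCompletionIntegers ℚ)
  have hsemi := W.localPolynomialAt_baseChange_of_isSemistableAt K hw hss hvL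
  rw [hf1, dickson_one, eval_X, pow_one] at hsemi
  set LD := (W.quadraticTwist (NumberField.discr K : ℚ)).localPolynomialAt v with hLD
  set Lv := W.localPolynomialAt v with hLv
  have hLv0 : Lv ≠ 0 := fun h ↦ by
    have := coeff_zero_localPolynomialAt W v
    rw [← hLv, h, coeff_zero] at this
    exact zero_ne_one this
  have hvL' : Lv = 1 - C t * X + C δ * X ^ 2 := hvL
  have key : Lv * LD = Lv * 1 := by rw [mul_one, ← hmul, hsemi, hvL']
  exact mul_left_cancel₀ hLv0 key

/-- Consequently the local Euler factor of `E^{(d_K)}` at such a place is `1`.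
[cite: SilvermanAEC2009, VII.5.4 and §C.16] -/
theorem localEulerFactor_quadraticTwist_discr_eq_one_of_dvd_of_isSemistableAt
    (h2 : Module.finrank ℚ K = 2) (v : HeightOneSpectrum (𝓞 ℚ))
    (hv : ((primesEquiv v : ℕ) : ℤ) ∣ NumberField.discr K) (hss : W.IsSemistableAt v) :
    ((W.quadraticTwist (NumberField.discr K : ℚ)).baseChange (v.adicCompletion ℚ)).localEulerFactor
        (v.adicCompletionIntegers ℚ) = 1 := by
  have hlp := W.localPolynomialAt_quadraticTwist_discr_eq_one_of_dvd_of_isSemistableAt K h2 v hv hss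
  rw [localPolynomialAt] at hlp
  have hps : ((W.quadraticTwist (NumberField.discr K : ℚ)).baseChange (v.adicCompletion ℚ)).localPowerSeries
      (v.adicCompletionIntegers ℚ) = 1 := by
    rw [localPowerSeries, hlp, Polynomial.coe_one]
    have h1 := PowerSeries.mul_invOfUnit (1 : PowerSeries ℤ) 1 (by simp)
    rwa [one_mul] at h1
  rw [localEulerFactor, hps, map_one]

end Semistable

/-! ## §2 `a_{p^k}(E^{(d)}) = χ_d(p)^k a_{p^k}(E)` for a fundamental discriminant `d` -/

section PrimePow

variable (W : WeierstrassCurve ℚ) [W.IsElliptic]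

omit [W.IsElliptic] in
/-- From an identity of local Euler factors `L_v(E', ·) = rescale_t L_v(E, ·)` to the
prime-power coefficients: `a_{p^k}(E') = t^k a_{p^k}(E)`. [folklore] -/
private theorem LFunction_prime_pow_eq_of_localEulerFactor_eq_rescale (W' : WeierstrassCurve ℚ)
    (v : HeightOneSpectrum (𝓞 ℚ)) (t : ℤ)
    (h : (W'.baseChange (v.adicCompletion ℚ)).localEulerFactor (v.adicCompletionIntegers ℚ) =
      ArithmeticFunction.ofPowerSeries (primesEquiv v : ℕ)
        (PowerSeries.rescale t
          ((W.baseChange (v.adicCompletion ℚ)).localPowerSeries (v.adicCompletionIntegers ℚ))))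
    (k : ℕ) :
    W'.LFunction ((primesEquiv v : ℕ) ^ k) = t ^ k * W.LFunction ((primesEquiv v : ℕ) ^ k) := by
  have hp1 : 1 < (primesEquiv v : ℕ) := (primesEquiv v).2.one_lt
  have h1 := DFunLike.congr_fun h ((primesEquiv v : ℕ) ^ k)
  rw [localEulerFactor, natCard_residueField_adicCompletionIntegers,
    ArithmeticFunction.ofPowerSeries_apply_pow hp1, ArithmeticFunction.ofPowerSeries_apply_pow hp1,
    PowerSeries.coeff_rescale] at h1
  rw [W'.LFunction_apply_prime_pow v k, W.LFunction_apply_prime_pow v k, h1]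

/-- From a trivial local Euler factor to the vanishing of the prime-power coefficients:
`a_{p^k}(E') = 0` for `k ≥ 1`. [folklore] -/
private theorem LFunction_prime_pow_eq_zero_of_localEulerFactor_eq_one (W' : WeierstrassCurve ℚ)
    (v : HeightOneSpectrum (𝓞 ℚ))
    (h : (W'.baseChange (v.adicCompletion ℚ)).localEulerFactor (v.adicCompletionIntegers ℚ) = 1)
    {k : ℕ} (hk : k ≠ 0) : W'.LFunction ((primesEquiv v : ℕ) ^ k) = 0 := by
  have hp1 : 1 < (primesEquiv v : ℕ) := (primesEquiv v).2.one_lt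
  have h1 := DFunLike.congr_fun h ((primesEquiv v : ℕ) ^ k)
  rw [localEulerFactor, natCard_residueField_adicCompletionIntegers,
    ArithmeticFunction.ofPowerSeries_apply_pow hp1, ArithmeticFunction.one_apply,
    if_neg (by
      intro h'
      have := (Nat.pow_eq_one.mp h')
      rcases this with h'' | h''
      · exact hp1.ne' h''
      · exact hk h'')] at h1
  rw [W'.LFunction_apply_prime_pow v k, h1]

/-- **`a_{p^k}(E^{(d)}) = χ_d(p)^k · a_{p^k}(E)`** for an elliptic curve `E / ℚ` (any model `W`), a
fundamental discriminant `d`, a prime `p` and `k ≥ 0`, provided `E` is SEMISTABLE at every prime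
dividing `d`; here `χ_d(p)` is the Kronecker value of `ℚ(√d)` at `p` (`(d/p)` for odd `p`; `0`,
`±1` at `p = 2` as `d` is even, `≡ 1, 5 (mod 8)`). At `p ∤ d` this is the rescaling of the local
factor by `χ_d(p)` (Silverman *AEC* X.2, Exercise 10.16: `L(E^{(d)}, s) = L(E ⊗ χ_d, s)` at the
unramified primes); at `p ∣ d` both sides vanish for `k ≥ 1` (`§1`: the twist has trivial Euler
factor at a ramified prime of semistable reduction). [cite: SilvermanAEC2009, X.2 and Exercise 10.16, §C.16] -/
theorem LFunction_quadraticTwist_prime_pow_of_fundamental {d : ℤ}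
    (hfund : (d % 4 = 1 ∧ Squarefree d ∧ d ≠ 1) ∨
      (4 ∣ d ∧ (d / 4 % 4 = 2 ∨ d / 4 % 4 = 3) ∧ Squarefree (d / 4)))
    (hss : ∀ v : HeightOneSpectrum (𝓞 ℚ), ((primesEquiv v : ℕ) : ℤ) ∣ d → W.IsSemistableAt v)
    {p : ℕ} (hp : p.Prime) (k : ℕ) :
    (W.quadraticTwist (d : ℚ)).LFunction (p ^ k) =
      (if p = 2 then (if (2 : ℤ) ∣ d then 0 else if d % 8 = 1 then 1 else -1) else J(d | p)) ^ k *
        W.LFunction (p ^ k) := by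
  obtain ⟨v, rfl⟩ : ∃ v : HeightOneSpectrum (𝓞 ℚ), (primesEquiv v : ℕ) = p :=
    ⟨primesEquiv.symm ⟨p, hp⟩, by rw [Equiv.apply_symm_apply]⟩
  have hd0 : d ≠ 0 := by
    rintro rfl
    rcases hfund with ⟨h1, -, -⟩ | ⟨-, -, hsq⟩
    · norm_num at h1
    · simp at hsq
  by_cases hpd : ((primesEquiv v : ℕ) : ℤ) ∣ d
  · -- `p ∣ d`: the twist has trivial Euler factor at `v`; both sides vanish for `k ≥ 1`
    have ht : (if (primesEquiv v : ℕ) = 2 then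
        (if (2 : ℤ) ∣ d then 0 else if d % 8 = 1 then 1 else -1)
        else J(d | (primesEquiv v : ℕ))) = 0 := by
      by_cases h2 : (primesEquiv v : ℕ) = 2
      · have h2d : (2 : ℤ) ∣ d := by
          rw [← show ((primesEquiv v : ℕ) : ℤ) = 2 by exact_mod_cast h2]; exact hpd
        rw [if_pos h2, if_pos h2d]
      · rw [if_neg h2]
        haveI : NeZero (primesEquiv v : ℕ) := ⟨hp.ne_zero⟩
        rw [jacobiSym.eq_zero_iff_not_coprime]
        intro hg
        have hcp : IsCoprime d ((primesEquiv v : ℕ) : ℤ) := Int.isCoprime_iff_gcd_eq_one.mpr hg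
        have hu : IsUnit ((primesEquiv v : ℕ) : ℤ) := hcp.symm.isUnit_of_dvd' (dvd_refl _) hpd
        rw [Int.isUnit_iff_natAbs_eq, Int.natAbs_natCast] at hu
        exact hp.one_lt.ne' hu
    rw [ht]
    rcases Nat.eq_zero_or_pos k with rfl | hk
    · simp only [pow_zero, one_mul, W.isMultiplicative_LFunction.map_one,
        (W.quadraticTwist (d : ℚ)).isMultiplicative_LFunction.map_one]
    · rw [zero_pow hk.ne', zero_mul]
      -- a quadratic field of discriminant `d`
      obtain ⟨K', _, _, h2', hdK⟩ :=
        Literature.NumberTheory.QuadraticFields.Quadratic.exists_numberField_discr_eq hfund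
      have h := W.localEulerFactor_quadraticTwist_discr_eq_one_of_dvd_of_isSemistableAt K' h2' v
        (by rw [hdK]; exact hpd) (hss v hpd)
      rw [hdK] at h
      exact LFunction_prime_pow_eq_zero_of_localEulerFactor_eq_one (W.quadraticTwist (d : ℚ)) v h
        hk.ne'
  · -- `p ∤ d`: the local factor of the twist is the rescaling by `χ_d(p)`
    rcases hfund with ⟨hd4, -, -⟩ | ⟨h4, -, -⟩
    · -- odd `d`
      by_cases hv2 : (primesEquiv v : ℕ) = 2
      · have hJ : J(((primesEquiv v : ℕ) : ℤ) | d.natAbs) =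
            (if (2 : ℤ) ∣ d then 0 else if d % 8 = 1 then 1 else -1) := by
          rw [show ((primesEquiv v : ℕ) : ℤ) = 2 by exact_mod_cast hv2, if_neg (by omega)]
          have hgcd : Int.gcd 2 d.natAbs = 1 := by
            have hodd : Odd d.natAbs := by rw [Int.natAbs_odd]; exact Int.odd_iff.mpr (by omega)
            rw [Int.gcd_eq_natAbs, Int.natAbs_natCast]
            exact Nat.coprime_two_left.mpr hodd
          rcases jacobiSym.eq_one_or_neg_one hgcd with h1 | h1
          · rw [h1, if_pos ((Literature.NumberTheory.QuadraticFields.jacobiSym_two_natAbs_eq_one_iff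
              hd4).mp h1)]
          · rw [h1, if_neg]
            intro h8
            have := (Literature.NumberTheory.QuadraticFields.jacobiSym_two_natAbs_eq_one_iff hd4).mpr h8
            rw [h1] at this
            norm_num at this
        have h := W.localEulerFactor_quadraticTwist_two_of_emod_four_eq_one hd4 v hv2
        rw [if_pos hv2, ← hJ]
        exact LFunction_prime_pow_eq_of_localEulerFactor_eq_rescale W _ v _ h k
      · have h := W.localEulerFactor_quadraticTwist_of_odd_of_not_dvd hd4 v hv2 hpd
        have hJ : J(((primesEquiv v : ℕ) : ℤ) | d.natAbs) = J(d | (primesEquiv v : ℕ)) :=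
          Literature.NumberTheory.QuadraticFields.jacobiSym_natAbs_eq_of_emod_four_eq_one hd4
            (hp.odd_of_ne_two hv2)
        rw [if_neg hv2, ← hJ]
        exact LFunction_prime_pow_eq_of_localEulerFactor_eq_rescale W _ v _ h k
    · -- even `d = 4m`: `p` is odd
      obtain ⟨m, rfl⟩ := h4
      have hv2 : (primesEquiv v : ℕ) ≠ 2 := by
        intro h2
        apply hpd
        rw [h2]
        exact ⟨2 * m, by push_cast; ring⟩
      have h := W.localEulerFactor_quadraticTwist_four_mul_of_not_dvd m v hpd
      have hgcd : Int.gcd 2 (primesEquiv v : ℕ) = 1 := by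
        rw [Int.gcd_eq_natAbs, Int.natAbs_natCast]
        exact Nat.coprime_two_left.mpr (hp.odd_of_ne_two hv2)
      have hJ : J(m | (primesEquiv v : ℕ)) = J(4 * m | (primesEquiv v : ℕ)) := by
        rw [jacobiSym.mul_left, show (4 : ℤ) = 2 ^ 2 by norm_num, jacobiSym.sq_one' hgcd, one_mul]
      rw [if_neg hv2, ← hJ]
      exact LFunction_prime_pow_eq_of_localEulerFactor_eq_rescale W _ v _ h k

end PrimePow

/-! ## §3 The Euler product of `L(E^{(d)}, s)` through the coefficients of `E` -/

section EulerProduct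

variable (W : WeierstrassCurve ℚ) [W.IsElliptic]

/-- **`L(E^{(d)}, s) = ∏_p (1 − χ_d(p) a_p(E) p⁻ˢ + e_p χ_d(p)² p⁻²ˢ)⁻¹` for `re s > 3/2`**
(`HasProd` over `Nat.Primes`; `e_p = p` if `p ∤ N_E`, `0` if `p ∣ N_E`; `a_p(E) = W.LFunction p`):
the Euler product of the Dirichlet series of the twist `E^{(d)}` by a fundamental discriminant `d`
at whose prime divisors `E` is semistable, with its `p`-factors expressed through `E` and the
Kronecker value `χ_d(p)` (`LFunction_quadraticTwist_prime_pow_of_fundamental` at `k = 1, 2`, the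
recursion `a_{p²} = a_p² − e_p`). These are the factors `L(Aᵢ, s)`, `Aᵢ = E^{(dᵢ)}`, of Gross's
`L(f, χ, s) = L(A₁, s) L(A₂, s)`. [cite: SilvermanAEC2009, X.2, Exercise 10.16 and §C.16]
[cite: Gross2004, §2 p. 40] -/
theorem hasProd_LSeries_quadraticTwist_of_fundamental {d : ℤ}
    (hfund : (d % 4 = 1 ∧ Squarefree d ∧ d ≠ 1) ∨
      (4 ∣ d ∧ (d / 4 % 4 = 2 ∨ d / 4 % 4 = 3) ∧ Squarefree (d / 4)))
    (hss : ∀ v : HeightOneSpectrum (𝓞 ℚ), ((primesEquiv v : ℕ) : ℤ) ∣ d → W.IsSemistableAt v)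
    {s : ℂ} (hs : (3 / 2 : ℝ) < s.re) :
    HasProd (fun p : Nat.Primes ↦
      (1 - ((if (p : ℕ) = 2 then (if (2 : ℤ) ∣ d then 0 else if d % 8 = 1 then 1 else -1)
            else J(d | (p : ℕ)) : ℤ) : ℂ) * (W.LFunction p : ℂ) * (p : ℂ) ^ (-s) +
        (if (p : ℕ) ∣ W.conductorNorm ℤ then 0 else (p : ℂ)) *
          ((if (p : ℕ) = 2 then (if (2 : ℤ) ∣ d then 0 else if d % 8 = 1 then 1 else -1)
            else J(d | (p : ℕ)) : ℤ) : ℂ) ^ 2 * ((p : ℂ) ^ (-s)) ^ 2)⁻¹)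
      ((W.quadraticTwist (d : ℚ)).LSeries s) := by
  have hd0 : d ≠ 0 := by
    rintro rfl
    rcases hfund with ⟨h1, -, -⟩ | ⟨-, -, hsq⟩
    · norm_num at h1
    · simp at hsq
  have hdq : (d : ℚ) ≠ 0 := by exact_mod_cast hd0
  haveI : (W.quadraticTwist (d : ℚ)).IsElliptic := W.isElliptic_quadraticTwist hdq
  set W' := W.quadraticTwist (d : ℚ) with hW'
  -- the Euler product of `L(E^{(d)}, s)` through its own coefficients
  have hmul := W'.isMultiplicative_LFunction
  have hprod := Literature.NumberTheory.Automorphic.LSeries_hasProd_of_recurrence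
    (a := fun n ↦ (W'.LFunction n : ℂ))
    (e := fun p ↦ if p ∣ W'.conductorNorm ℤ then 0 else (p : ℂ))
    (by simp [hmul.map_one])
    (fun hmn ↦ by simp [hmul.map_mul_of_coprime hmn])
    (fun hp r ↦ by
      have := W'.LFunction_apply_prime_pow_add_two_of_prime hp r
      simp only [this, Int.cast_sub, Int.cast_mul]
      split_ifs <;> simp)
    (WeierstrassCurve.LSeriesSummable_of_lt_re_holds W' hs)
  refine (hprod.congr_fun fun p ↦ ?_)
  -- identify the `p`-factor: `a_p(E^{(d)}) = t a_p`, `e_p(E^{(d)}) = t² e_p`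
  set t : ℤ := (if (p : ℕ) = 2 then (if (2 : ℤ) ∣ d then 0 else if d % 8 = 1 then 1 else -1)
    else J(d | (p : ℕ))) with htdef
  have h1 := W.LFunction_quadraticTwist_prime_pow_of_fundamental hfund hss p.2 1
  have h2 := W.LFunction_quadraticTwist_prime_pow_of_fundamental hfund hss p.2 2
  rw [← htdef, ← hW'] at h1 h2
  simp only [pow_one] at h1
  -- `e_p = a_p² − a_{p²}` for both curves
  have heW := W.LFunction_apply_prime_pow_add_two_of_prime p.2 0
  have heW' := W'.LFunction_apply_prime_pow_add_two_of_prime p.2 0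
  rw [zero_add, pow_one, pow_zero, hmul.map_one, mul_one] at heW'
  rw [zero_add, pow_one, pow_zero, W.isMultiplicative_LFunction.map_one, mul_one] at heW
  have he : ((if (p : ℕ) ∣ W'.conductorNorm ℤ then 0 else ((p : ℕ) : ℤ)) : ℤ) =
      t ^ 2 * (if (p : ℕ) ∣ W.conductorNorm ℤ then 0 else ((p : ℕ) : ℤ)) := by
    have e1 : ((if (p : ℕ) ∣ W'.conductorNorm ℤ then 0 else ((p : ℕ) : ℤ)) : ℤ) =
        W'.LFunction p * W'.LFunction p - W'.LFunction ((p : ℕ) ^ 2) := by rw [heW']; ring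
    have e2 : ((if (p : ℕ) ∣ W.conductorNorm ℤ then 0 else ((p : ℕ) : ℤ)) : ℤ) =
        W.LFunction p * W.LFunction p - W.LFunction ((p : ℕ) ^ 2) := by rw [heW]; ring
    rw [e1, e2, h1, h2]; ring
  have he' : ((if (p : ℕ) ∣ W'.conductorNorm ℤ then 0 else ((p : ℕ) : ℂ)) : ℂ) =
      (t : ℂ) ^ 2 * (if (p : ℕ) ∣ W.conductorNorm ℤ then 0 else ((p : ℕ) : ℂ)) := by
    have := congrArg (fun z : ℤ ↦ (z : ℂ)) he
    push_cast at this
    exact this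
  have h1' : ((W'.LFunction p : ℤ) : ℂ) = (t : ℂ) * (W.LFunction p : ℂ) := by
    rw [h1]; push_cast; ring
  rw [h1', he']
  ring

end EulerProduct

end WeierstrassCurve

end
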